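/-
Copyright (c) 2026 the pub-hodgecm-mathlib formalisation cell (harness21).  Prover seat hodgecm-mathlib-K2E3-p24 (g0), Track B «K2-LIT» ∕ h413
(`stmt-HodgeConjecture-24833`), line `K2_E3_EllipticInputs`, road (11-3-split-nsc), leaf (nsc-S-C′) `sig_K2E3GL3TwoBlockCuspidalSupportCharLocInt`,
brick (RN′): Radon–Nikodym for a push-forward functional with an INTEGRABLE (not bounded) complex weight.  2026-09-04.
-/
import Summits.HodgeConjecture.HodgeConjecture.Theorems.K2E3PushforwardDensityOfDomination   -- ★ (nsc-RN) p858445 (K2E3-p03∕p11): `exists_integrable_forall_integral_mul_comp_eq` (bounded weight)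
import HarnessLib

/-!
# K2_E3 road (h413), leaf (nsc-S-C′), brick (RN′) — a push-forward functional `f ↦ ∫_X F·(f∘Ψ) dμ_X` with `F ∈ L¹(μ_X)` (UNBOUNDED) and
# `(Ψ_*μ_X)|_U ≪ μ_G` is `f ↦ ∫_G f·Θ dμ_G` with `Θ ∈ L¹(μ_G)`

Cell `pub/hodgecm-mathlib` (D-0151), Track B, seat K2E3-p24 (g0) = hand of the hosted leaf (nsc-S-C′) (road owner K2E3-p11 (g6) TIE-CAND v0 1e894c21; refuter
K2E3-r01 (g4) flag 08:14:34Z: «(S-C′) needs (nsc-RN) with `F ∈ L¹(μX)` (finite total variation) rather than `‖F‖ ≤ M` — a 10-line variant of ★ p858445»).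
`--supports stmt-HodgeConjecture-24833 --as helper`; THEOREMS ONLY (no definition ∕ instance ∕ notation ∕ named fact ∕ `sorry`); never imports `Cruxes/…/Lines`.
COUNT-NEUTRAL.

THE MATHEMATICS ([Folland1999, §3.2 Thm. 3.8, Prop. 3.9]).  In van Dijk's `K M U` form of the character of `Ind_{P_c}(σ)` for a NON-one-dimensional supercuspidal
inducing datum `σ`, the weight on the parameter space `X = K × M_c × U_c` is `C·Θ_σ(m)·δ^{1∕2}(m)` with `Θ_σ` merely LOCALLY INTEGRABLE on `M_c` [HarishChandra1970]
(not bounded near the singular set), so after localisation the weight is in `L¹(μ_X)` but not in `L^∞`.  The Radon–Nikodym step is unchanged: replace `μ_X` by the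
finite measure `|F|·μ_X` (`withDensity ‖F‖₊`) and `F` by its bounded phase `F∕|F|`; absolute continuity of the push-forward passes to `|F|·μ_X ≪ μ_X`, and ★ (nsc-RN)
applies.

* **`exists_integrable_forall_integral_mul_comp_eq_of_integrable`** — `Ψ : X → G` measurable, `F : X → ℂ` measurable and `μ_X`-integrable, `μ_G` σ-finite,
  `U` measurable, `((Ψ_*μ_X)|_U) ≪ μ_G` ⟹ `∃ Θ ∈ L¹(μ_G)`, `∫_X F·(f∘Ψ) dμ_X = ∫_G f·Θ dμ_G` for every bounded measurable `f : G → ℂ` vanishing off `U`.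
  (No finiteness of `μ_X` is needed: `|F|·μ_X` is finite.)

HONEST LABEL: HC_CM is proved only modulo the 7 printed citations (2 remaining named inputs: hLiu418 = stmt-HodgeConjecture-24832, h413 =
stmt-HodgeConjecture-24833) until rung 0 closes; count-neutral helper (pure measure theory).

## References
* [Folland1999] G. B. Folland, *Real Analysis*, 2nd ed. (1999), §3.2 Thm. 3.8 p. 90, Prop. 3.9.
* [HarishChandra1970] Harish-Chandra (notes by G. van Dijk), *Harmonic analysis on reductive 𝔭-adic groups*, LNM 162 (1970).
-/

set_option autoImplicit false
set_option linter.dupNamespace false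

noncomputable section

open MeasureTheory Measure Set
open scoped NNReal ENNReal

namespace Summit.HodgeConjecture.HodgeConjecture.Cruxes.H413.K2E3PushforwardDensityOfIntegrable

open Summit.HodgeConjecture.HodgeConjecture.Cruxes.H413.K2E3PushforwardDensityOfDomination

variable {X G : Type*} [MeasurableSpace X] [MeasurableSpace G]

/-- **Radon–Nikodym for a push-forward functional with an integrable complex weight.**  `Ψ : X → G` measurable, `F : X → ℂ` measurable and integrable for `μ_X`,
`μ_G` σ-finite, `U ⊆ G` measurable with `((Ψ_*μ_X)|_U) ≪ μ_G`: there is `Θ : G → ℂ` integrable for `μ_G` with `∫_X F(x)·f(Ψ x) dμ_X = ∫_G f·Θ dμ_G` for every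
bounded measurable `f : G → ℂ` vanishing off `U`.  Proof: ★ (nsc-RN) `exists_integrable_forall_integral_mul_comp_eq` for the finite measure `‖F‖·μ_X` and the bounded
phase `F∕‖F‖`. [cite: Folland1999, §3.2 Thm. 3.8 p. 90] -/
theorem exists_integrable_forall_integral_mul_comp_eq_of_integrable (μX : Measure X) {Ψ : X → G} (hΨ : Measurable Ψ)
    {F : X → ℂ} (hF : Measurable F) (hFi : Integrable F μX)
    (μG : Measure G) [SigmaFinite μG] {U : Set G} (hU : MeasurableSet U) (hac : ((μX.map Ψ).restrict U) ≪ μG) :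
    ∃ Θ : G → ℂ, Integrable Θ μG ∧ ∀ (f : G → ℂ) (B : ℝ), Measurable f → (∀ g, ‖f g‖ ≤ B) → (∀ g, g ∉ U → f g = 0) →
      ∫ x, F x * f (Ψ x) ∂μX = ∫ g, f g * Θ g ∂μG := by
  classical
  -- the finite measure `‖F‖·μ_X`
  set w : X → ℝ≥0 := fun x => ‖F x‖₊ with hw
  have hwm : Measurable w := hF.nnnorm
  set μ' : Measure X := μX.withDensity fun x => (w x : ℝ≥0∞) with hμ'
  haveI : IsFiniteMeasure μ' := by
    refine isFiniteMeasure_withDensity (ne_of_lt ?_)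
    have h := hFi.hasFiniteIntegral
    rw [hasFiniteIntegral_iff_enorm] at h
    simpa [hw, enorm_eq_nnnorm] using h
  -- the bounded phase `F ∕ ‖F‖`
  set P : X → ℂ := fun x => if F x = 0 then 0 else F x / (‖F x‖ : ℂ) with hP
  have hPm : Measurable P := Measurable.ite (hF (measurableSet_singleton 0)) measurable_const
    (hF.div (Complex.measurable_ofReal.comp hF.norm))
  have hPb : ∀ x, ‖P x‖ ≤ 1 := by
    intro x
    by_cases hx : F x = 0
    · simp [hP, hx]
    · simp only [hP, hx, if_false, norm_div, Complex.norm_real, norm_norm]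
      rw [div_self (norm_ne_zero_iff.2 hx)]
  have hwP : ∀ x, w x • P x = F x := by
    intro x
    rw [NNReal.smul_def]
    by_cases hx : F x = 0
    · simp [hP, hw, hx]
    · simp only [hP, hw, hx, if_false, coe_nnnorm, Complex.real_smul]
      rw [mul_div_cancel₀ _ (by exact_mod_cast norm_ne_zero_iff.2 hx)]
  -- absolute continuity passes to `‖F‖·μ_X`
  have hac' : ((μ'.map Ψ).restrict U) ≪ μG :=
    (((withDensity_absolutelyContinuous μX _).map hΨ).restrict U).trans hac
  -- ★ (nsc-RN) for the bounded phase
  obtain ⟨Θ, hΘ, h⟩ := exists_integrable_forall_integral_mul_comp_eq μ' hΨ hPm hPb μG hU hac'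
  refine ⟨Θ, hΘ, fun f B hfm hfb hfU => ?_⟩
  rw [← h f B hfm hfb hfU, hμ', integral_withDensity_eq_integral_smul hwm]
  refine integral_congr_ae (Filter.Eventually.of_forall fun x => ?_)
  simp only
  rw [← smul_mul_assoc, hwP x]

end Summit.HodgeConjecture.HodgeConjecture.Cruxes.H413.K2E3PushforwardDensityOfIntegrable

end
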